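import Summits.AtomisticToContinuum.BoseEinsteinCondensation.Theses.BECChargeConjugationRP
import HarnessLib.Audit

/-!
# Birth skeleton (BC3) for crux `BECChargeConjugationRP.ChargedAnchorLRO`

Item stmt-AtomisticToContinuum-9045, route route-AtomisticToContinuum-BECChargeConjugationRP
(registrar planner-skel-stmt-AtomisticToContinuum-9045-0, 2026-08-17).

Crux (fixed, by name): `ChargedAnchorLRO` — for the lattice double-well `O(2)` quantum field
`H = Σ_x [(c²/2)(−Δ_{Φ_x}) + lam (|Φ_x|² − w)²] + Σ_x Σ_i |Φ_{x+eᵢ} − Φ_x|²` on the even torus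
`(ℤ/nℤ)³`, every `δ`-near-minimiser of the variational energy in the CHARGE SECTOR `N`
(`Ψ(e^{iθ}Φ) = e^{iNθ}Ψ(Φ)`), `N ≤ ν₀ n³`, has zero-mode intensity `∫ |Σ_x Φ_x|² |Ψ|² ≥ M n⁶`,
with `ν₀, M` depending on `(c, lam, w)` only (deep wells `w ≥ w₀`).

## The line: SUM RULE + CHARGED INFRARED BOUND (Fröhlich–Simon–Spencer / Dyson–Lieb–Simon /
Kennedy–Lieb–Shastry architecture, written in position space)

Pointwise Parseval identity on the torus: `n³ Σ_x |Φ_x|² = |Σ_x Φ_x|² + D(Φ)` with the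
NON-ZERO-MODE CONTENT `D(Φ) := n³ Σ_x |Φ_x|² − |Σ_x Φ_x|² = ½ Σ_{x,y} |Φ_x − Φ_y|² = n³ Σ_{k≠0} |Φ̂_k|² ≥ 0`
(Cauchy–Schwarz). Hence for any state
`∫ |ΣΦ|² |Ψ|² = n³ ∫ (Σ_x|Φ_x|²) |Ψ|² − ∫ D |Ψ|²`, and LRO follows from

* `stub_onSiteMomentFloor` (SUM-RULE SIDE, size M): deep wells pin the on-site second moment —
  for every target `A` there is `w₀(A, c, lam)` such that near-minimisers in every sector
  `N ≤ ν₀ n³` have `∫ (Σ_x |Φ_x|²) |Ψ|² ≥ A n³` (expected `≈ w n³ (1 − o(1))`: a priori energy bound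
  `E₀(N) ≤ E₀(0) + O(c² ν₀² n³ / w)` by a charged trial state `(Σ_x Φ_x)^N ·` (sector-0 state),
  then Cauchy–Schwarz on `Σ_x ⟨lam (|Φ_x|² − w)²⟩ ≤ E₀(N) + δ`). The only place the charge enters is
  the charging energy `N²/(2χ)`, `χ ~ w n³ / c²`.
* `stub_chargedInfraredBound` (INFRARED SIDE, the HEART, size XL / open): the non-zero-mode content
  of near-minimisers is `≤ B n⁶` with `B = B(c, lam)` UNIFORM in the well depth `w ≥ w₁` and in the
  charge `N ≤ ν₀ n³`. At `N = 0` this is the `T = 0` KLS infrared bound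
  `⟨|Φ̂_k|²⟩ ≤ ½ (b_k c_k)^{1/2}`, `b_k ≤ 1/(2E_k)` (Gaussian domination from reflection positivity
  through bond planes for the REAL operators `Re Φ, Im Φ`), `c_k = O(c²)` (double commutator of the
  kinetic term), summable in `d = 3`: `B ~ c · (2π)⁻³ ∫ E_k^{-1/2} d³k`, independent of `w, lam`
  (KLS1988PRL eqs. (3)–(4); DysonLiebSimon1978; FrohlichSimonSpencer1976). In a sector `Q ≠ 0`
  reflection positivity is LOST (barrier `HalfFillingReflectionPositivity`; the route's
  `rp_oddCharge_eq_zero` remark): the stub is exactly the statement that the infrared bound survives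
  a small charge density with a degraded constant — the crux's advertised difficulty, isolated from
  the (routine) sum-rule side. Candidate engines: charge-insertion expansion relative to the RP
  point (the charged ground state as `(Σ_xΦ_x)^N`-descendant of the vacuum plus corrections
  controlled by the charging gap), positive-weight dual current representations at `Q ≠ 0`
  (arXiv:1206.2954, QuitmannTaggi2023), or a variational IR bound (Pitaevskii–Stringari-type
  uncertainty inequality with the sector-`N` ground state, which needs no RP).

Composition `ChargedAnchorLRO_of` (sorry-free, below): choose `B, w₁` from the infrared stub, then
`A := max B 0 + 1` in the sum-rule stub; for `w ≥ max w₀ w₁`, `ν₀ := min`, `n₀ := max`, `δ := min`,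
the Parseval identity integrated against `|Ψ|²` (measurability from `ContDiff ℝ 1 Ψ`) gives
`∫ |ΣΦ|²|Ψ|² ≥ (A − max B 0) n⁶ = n⁶`, i.e. the crux with `M = 1`.

Disproof used: none — no `Cruxes/ChargedAnchorLRO/Disproof.lean` exists at registration
(`ledger crux ls stmt-AtomisticToContinuum-9045`: no workfiles); negatives index
(`ledger negatives --problem AtomisticToContinuum`, 20 entries, 1 in this sub-problem:
`BECPopovBerryRG.BerryStiffPhaseLRO`) contains nothing of the shape of either stub.
Barriers: `HalfFillingReflectionPositivity` bites `stub_chargedInfraredBound` and nothing else (the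
sum-rule stub and the seam use no RP); `SymmetryBreakingWithoutCondensate` respected (everything is
a two-point / zero-mode quantity in a fixed sector); `BogoliubovPerturbationInfrared`: the IR stub
asks for the non-perturbative `1/E_k` bound, not a Bogoliubov expansion.
-/

namespace Summit.AtomisticToContinuum.BoseEinsteinCondensation.Cruxes.ChargedAnchorLRO.Birth

open scoped BigOperators ENNReal
open MeasureTheory
open Summit.AtomisticToContinuum.BoseEinsteinCondensation.Theses.BECChargeConjugationRP
  (ChargedAnchorLRO)

noncomputable section

/-! ## The model of the crux, named (bodies copied verbatim from the `let`s of `ChargedAnchorLRO`) -/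

/-- The sector energy functional `E` of `ChargedAnchorLRO` (double well `lam (|Φ_x|² − w)²`,
kinetic prefactor `c²/2`, nearest-neighbour gradient term) on wave functions
`Ψ : ℂ^{(ℤ/nℤ)³} → ℂ`. -/
def energy (c lam w : ℝ) (n : ℕ) [NeZero n] (Ψ : ((Fin 3 → ZMod n) → ℂ) → ℂ) : ℝ≥0∞ :=
  ∫⁻ Φ, ENNReal.ofReal (c ^ 2 / 2) * (∑ x, ((‖fderiv ℝ Ψ Φ (Pi.single x 1)‖₊ : ENNReal) ^ 2 +
    (‖fderiv ℝ Ψ Φ (Pi.single x Complex.I)‖₊ : ENNReal) ^ 2)) +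
    ENNReal.ofReal (∑ x, (lam * (‖Φ x‖ ^ 2 - w) ^ 2 + ∑ i : Fin 3, ‖Φ (x + Pi.single i 1) - Φ x‖ ^ 2)) *
    (‖Ψ Φ‖₊ : ENNReal) ^ 2

/-- The admissibility predicate `T` of `ChargedAnchorLRO`: `C¹`, normalised, charge sector `N`. -/
def IsSectorState (n : ℕ) [NeZero n] (N : ℕ) (Ψ : ((Fin 3 → ZMod n) → ℂ) → ℂ) : Prop :=
  ContDiff ℝ 1 Ψ ∧ ∫⁻ Φ, (‖Ψ Φ‖₊ : ENNReal) ^ 2 = 1 ∧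
    ∀ (θ : ℝ) (Φ : (Fin 3 → ZMod n) → ℂ), Ψ (fun x => Complex.exp (θ * Complex.I) * Φ x) =
      Complex.exp (N * θ * Complex.I) * Ψ Φ

/-- `δ`-near-minimiser of the sector-`N` energy (the hypothesis of the crux's conclusion). -/
def IsNearMin (c lam w : ℝ) (n : ℕ) [NeZero n] (N : ℕ) (δ : ℝ≥0∞)
    (Ψ : ((Fin 3 → ZMod n) → ℂ) → ℂ) : Prop :=
  IsSectorState n N Ψ ∧
    energy c lam w n Ψ ≤ (⨅ (Ψ' : ((Fin 3 → ZMod n) → ℂ) → ℂ) (_ : IsSectorState n N Ψ'),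
      energy c lam w n Ψ') + δ

/-- NON-ZERO-MODE CONTENT of a field configuration: `n³ Σ_x |Φ_x|² − |Σ_x Φ_x|²`
`= ½ Σ_{x,y} |Φ_x − Φ_y|² = n³ Σ_{k ≠ 0} |Φ̂_k|²` (Parseval on `(ℤ/nℤ)³`). -/
def fluctuation (n : ℕ) [NeZero n] (Φ : (Fin 3 → ZMod n) → ℂ) : ℝ :=
  (n : ℝ) ^ 3 * ∑ x, ‖Φ x‖ ^ 2 - ‖∑ x, Φ x‖ ^ 2

/-! ## The two stub STATEMENTS, named (so that the composition's hypotheses are read by name) -/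

/-- Statement of `stub_onSiteMomentFloor` (sum-rule side). -/
def OnSiteMomentFloor : Prop :=
  ∀ (c lam : ℝ), 0 < c → 0 < lam → ∀ A : ℝ, ∃ w₀ : ℝ, ∀ w : ℝ, w₀ ≤ w → ∃ ν₀ : ℝ, 0 < ν₀ ∧
    ∃ n₀ : ℕ, ∀ (n : ℕ) [NeZero n], Even n → n₀ ≤ n → ∀ N : ℕ, (N : ℝ) ≤ ν₀ * (n : ℝ) ^ 3 →
      ∃ δ : ℝ≥0∞, 0 < δ ∧ ∀ Ψ : ((Fin 3 → ZMod n) → ℂ) → ℂ, IsNearMin c lam w n N δ Ψ →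
        ENNReal.ofReal (A * (n : ℝ) ^ 3) ≤
          ∫⁻ Φ : (Fin 3 → ZMod n) → ℂ, ENNReal.ofReal (∑ x, ‖Φ x‖ ^ 2) * (‖Ψ Φ‖₊ : ℝ≥0∞) ^ 2

/-- Statement of `stub_chargedInfraredBound` (infrared side, the heart). -/
def ChargedInfraredBound : Prop :=
  ∀ (c lam : ℝ), 0 < c → 0 < lam → ∃ B : ℝ, ∃ w₁ : ℝ, ∀ w : ℝ, w₁ ≤ w → ∃ ν₀ : ℝ, 0 < ν₀ ∧
    ∃ n₀ : ℕ, ∀ (n : ℕ) [NeZero n], Even n → n₀ ≤ n → ∀ N : ℕ, (N : ℝ) ≤ ν₀ * (n : ℝ) ^ 3 →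
      ∃ δ : ℝ≥0∞, 0 < δ ∧ ∀ Ψ : ((Fin 3 → ZMod n) → ℂ) → ℂ, IsNearMin c lam w n N δ Ψ →
        ∫⁻ Φ : (Fin 3 → ZMod n) → ℂ, ENNReal.ofReal (fluctuation n Φ) * (‖Ψ Φ‖₊ : ℝ≥0∞) ^ 2 ≤
          ENNReal.ofReal (B * (n : ℝ) ^ 6)

/-! `Goal.stub_x` abbreviates the statement of the registered stub `stub_x`, so that the skeleton audit
(`#h21_check_skeleton`, by-name policy on hypothesis heads) reads the hypotheses of `ChargedAnchorLRO_of`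
as exactly the two declared stubs (pattern of `Cruxes/DensityResponse/Lines/force-balance-constitutive.lean`). -/
namespace Goal

/-- Statement of stub `stub_onSiteMomentFloor`. -/
abbrev stub_onSiteMomentFloor : Prop := OnSiteMomentFloor

/-- Statement of stub `stub_chargedInfraredBound`. -/
abbrev stub_chargedInfraredBound : Prop := ChargedInfraredBound

end Goal

/-! ## Stubs (registered; the ONLY sorries of the file) -/

/-- **stub (sum-rule side, size M).** ON-SITE MOMENT FLOOR: deep wells pin `Σ_x ⟨|Φ_x|²⟩` at any
prescribed level `A n³`, uniformly in the charge `N ≤ ν₀ n³` and in even `n ≥ n₀`, for all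
`δ`-near-minimisers (`δ` chosen last). Expected proof: charged trial state ⇒
`E₀(N) ≤ C(c, lam, w) n³` with `C = O(w) + O(c √(lam w))`, then Cauchy–Schwarz on the double well:
`Σ_x ⟨|Φ_x|²⟩ ≥ n³ (w − ((C n³ + δ)/(lam n³))^{1/2})`. -/
theorem stub_onSiteMomentFloor :
    ∀ (c lam : ℝ), 0 < c → 0 < lam → ∀ A : ℝ, ∃ w₀ : ℝ, ∀ w : ℝ, w₀ ≤ w → ∃ ν₀ : ℝ, 0 < ν₀ ∧
      ∃ n₀ : ℕ, ∀ (n : ℕ) [NeZero n], Even n → n₀ ≤ n → ∀ N : ℕ, (N : ℝ) ≤ ν₀ * (n : ℝ) ^ 3 →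
        ∃ δ : ℝ≥0∞, 0 < δ ∧ ∀ Ψ : ((Fin 3 → ZMod n) → ℂ) → ℂ, IsNearMin c lam w n N δ Ψ →
          ENNReal.ofReal (A * (n : ℝ) ^ 3) ≤
            ∫⁻ Φ : (Fin 3 → ZMod n) → ℂ, ENNReal.ofReal (∑ x, ‖Φ x‖ ^ 2) * (‖Ψ Φ‖₊ : ℝ≥0∞) ^ 2 := by
  sorry

/-- **stub (infrared side, the heart; size XL).** CHARGED INFRARED BOUND: the non-zero-mode
content `∫ (n³ Σ_x|Φ_x|² − |Σ_xΦ_x|²) |Ψ|² = n³ Σ_{k≠0} ⟨|Φ̂_k|²⟩` of near-minimisers is `≤ B n⁶`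
with `B = B(c, lam)` uniform in the well depth `w ≥ w₁` and in the charge `N ≤ ν₀ n³`
(`N = 0`: KLS `T = 0` infrared bound `⟨|Φ̂_k|²⟩ ≲ c E_k^{-1/2}` via RP Gaussian domination + double
commutator; `N ≠ 0`: no RP — the open step). -/
theorem stub_chargedInfraredBound :
    ∀ (c lam : ℝ), 0 < c → 0 < lam → ∃ B : ℝ, ∃ w₁ : ℝ, ∀ w : ℝ, w₁ ≤ w → ∃ ν₀ : ℝ, 0 < ν₀ ∧
      ∃ n₀ : ℕ, ∀ (n : ℕ) [NeZero n], Even n → n₀ ≤ n → ∀ N : ℕ, (N : ℝ) ≤ ν₀ * (n : ℝ) ^ 3 →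
        ∃ δ : ℝ≥0∞, 0 < δ ∧ ∀ Ψ : ((Fin 3 → ZMod n) → ℂ) → ℂ, IsNearMin c lam w n N δ Ψ →
          ∫⁻ Φ : (Fin 3 → ZMod n) → ℂ, ENNReal.ofReal (fluctuation n Φ) * (‖Ψ Φ‖₊ : ℝ≥0∞) ^ 2 ≤
            ENNReal.ofReal (B * (n : ℝ) ^ 6) := by
  sorry

/-! ## The seam (proved): Parseval / Cauchy–Schwarz on the torus -/

/-- Cauchy–Schwarz: `|Σ_x Φ_x|² ≤ n³ Σ_x |Φ_x|²` on `(ℤ/nℤ)³`. -/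
theorem norm_sum_sq_le (n : ℕ) [NeZero n] (Φ : (Fin 3 → ZMod n) → ℂ) :
    ‖∑ x, Φ x‖ ^ 2 ≤ (n : ℝ) ^ 3 * ∑ x, ‖Φ x‖ ^ 2 := by
  have hcard : ((Finset.univ : Finset (Fin 3 → ZMod n)).card : ℝ) = (n : ℝ) ^ 3 := by
    rw [Finset.card_univ, Fintype.card_fun, ZMod.card, Fintype.card_fin]
    push_cast
    ring
  calc ‖∑ x, Φ x‖ ^ 2 ≤ (∑ x, ‖Φ x‖) ^ 2 := by
        gcongr
        exact norm_sum_le _ _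
    _ ≤ ((Finset.univ : Finset (Fin 3 → ZMod n)).card : ℝ) * ∑ x, ‖Φ x‖ ^ 2 :=
        sq_sum_le_card_mul_sum_sq
    _ = (n : ℝ) ^ 3 * ∑ x, ‖Φ x‖ ^ 2 := by rw [hcard]

theorem fluctuation_nonneg (n : ℕ) [NeZero n] (Φ : (Fin 3 → ZMod n) → ℂ) :
    0 ≤ fluctuation n Φ :=
  sub_nonneg.mpr (norm_sum_sq_le n Φ)

/-- Pointwise Parseval split in `ℝ≥0∞`:
`n³ · (Σ_x|Φ_x|²) · |Ψ|² = (|Σ_xΦ_x|² + D(Φ)) · |Ψ|²`. -/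
theorem parseval_split (n : ℕ) [NeZero n] (Φ : (Fin 3 → ZMod n) → ℂ) (z : ℂ) :
    ENNReal.ofReal ((n : ℝ) ^ 3) * (ENNReal.ofReal (∑ x, ‖Φ x‖ ^ 2) * (‖z‖₊ : ℝ≥0∞) ^ 2) =
      ((‖∑ x, Φ x‖₊ : ℝ≥0∞) ^ 2 + ENNReal.ofReal (fluctuation n Φ)) * (‖z‖₊ : ℝ≥0∞) ^ 2 := by
  rw [← mul_assoc, ← ENNReal.ofReal_mul (by positivity)]
  congr 1
  rw [show (n : ℝ) ^ 3 * ∑ x, ‖Φ x‖ ^ 2 = ‖∑ x, Φ x‖ ^ 2 + fluctuation n Φ by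
        unfold fluctuation; ring,
    ENNReal.ofReal_add (by positivity) (fluctuation_nonneg n Φ), ENNReal.ofReal_pow (norm_nonneg _),
    ofReal_norm, enorm_eq_nnnorm]

/-- Integrated Parseval split: `n³ ∫ (Σ_x|Φ_x|²)|Ψ|² = ∫ |ΣΦ|²|Ψ|² + ∫ D|Ψ|²` for continuous `Ψ`. -/
theorem lintegral_parseval_split (n : ℕ) [NeZero n] (Ψ : ((Fin 3 → ZMod n) → ℂ) → ℂ)
    (hΨ : Continuous Ψ) :
    ENNReal.ofReal ((n : ℝ) ^ 3) *
        ∫⁻ Φ : (Fin 3 → ZMod n) → ℂ, ENNReal.ofReal (∑ x, ‖Φ x‖ ^ 2) * (‖Ψ Φ‖₊ : ℝ≥0∞) ^ 2 =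
      (∫⁻ Φ : (Fin 3 → ZMod n) → ℂ, (‖∑ x, Φ x‖₊ : ℝ≥0∞) ^ 2 * (‖Ψ Φ‖₊ : ℝ≥0∞) ^ 2) +
        ∫⁻ Φ : (Fin 3 → ZMod n) → ℂ, ENNReal.ofReal (fluctuation n Φ) * (‖Ψ Φ‖₊ : ℝ≥0∞) ^ 2 := by
  have hΨm : Measurable fun Φ : (Fin 3 → ZMod n) → ℂ => (‖Ψ Φ‖₊ : ℝ≥0∞) ^ 2 :=
    (hΨ.measurable.nnnorm.coe_nnreal_ennreal).pow_const 2
  have hSm : Measurable fun Φ : (Fin 3 → ZMod n) → ℂ => (‖∑ x, Φ x‖₊ : ℝ≥0∞) ^ 2 :=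
    ((continuous_finsetSum _ fun x _ => continuous_apply x).measurable.nnnorm.coe_nnreal_ennreal).pow_const
      2
  have hmeas : Measurable fun Φ : (Fin 3 → ZMod n) → ℂ =>
      (‖∑ x, Φ x‖₊ : ℝ≥0∞) ^ 2 * (‖Ψ Φ‖₊ : ℝ≥0∞) ^ 2 := hSm.mul hΨm
  rw [← lintegral_const_mul' _ _ ENNReal.ofReal_ne_top, ← lintegral_add_left hmeas]
  refine lintegral_congr fun Φ => ?_
  rw [parseval_split n Φ (Ψ Φ), add_mul]

/-! ## Composition: the two stubs prove the crux BY NAME (sorry-free; `_proof` applies it to the stubs) -/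

theorem ChargedAnchorLRO_of :
    Goal.stub_onSiteMomentFloor → Goal.stub_chargedInfraredBound →
      Summit.AtomisticToContinuum.BoseEinsteinCondensation.Theses.BECChargeConjugationRP.ChargedAnchorLRO := by
  intro hFloor hIR c lam hc hlam
  obtain ⟨B, w₁, hB⟩ := hIR c lam hc hlam
  obtain ⟨w₀, hA⟩ := hFloor c lam hc hlam (max B 0 + 1)
  refine ⟨max w₀ w₁, fun w hw => ?_⟩
  obtain ⟨ν₁, hν₁, n₁, h₁⟩ := hA w ((le_max_left _ _).trans hw)
  obtain ⟨ν₂, hν₂, n₂, h₂⟩ := hB w ((le_max_right _ _).trans hw)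
  refine ⟨min ν₁ ν₂, lt_min hν₁ hν₂, 1, one_pos, max n₁ n₂, ?_⟩
  intro n _ hn hn₀ N hN
  have hN₁ : (N : ℝ) ≤ ν₁ * (n : ℝ) ^ 3 :=
    hN.trans (mul_le_mul_of_nonneg_right (min_le_left _ _) (by positivity))
  have hN₂ : (N : ℝ) ≤ ν₂ * (n : ℝ) ^ 3 :=
    hN.trans (mul_le_mul_of_nonneg_right (min_le_right _ _) (by positivity))
  obtain ⟨δ₁, hδ₁, H₁⟩ := h₁ n hn ((le_max_left _ _).trans hn₀) N hN₁
  obtain ⟨δ₂, hδ₂, H₂⟩ := h₂ n hn ((le_max_right _ _).trans hn₀) N hN₂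
  show ∃ δ : ℝ≥0∞, 0 < δ ∧ ∀ Ψ : ((Fin 3 → ZMod n) → ℂ) → ℂ, IsSectorState n N Ψ →
    energy c lam w n Ψ ≤ (⨅ (Ψ' : ((Fin 3 → ZMod n) → ℂ) → ℂ) (_ : IsSectorState n N Ψ'),
      energy c lam w n Ψ') + δ →
      ENNReal.ofReal (1 * (n : ℝ) ^ 6) ≤
        ∫⁻ Φ : (Fin 3 → ZMod n) → ℂ, (‖∑ x, Φ x‖₊ : ℝ≥0∞) ^ 2 * (‖Ψ Φ‖₊ : ℝ≥0∞) ^ 2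
  refine ⟨min δ₁ δ₂, lt_min hδ₁ hδ₂, fun Ψ hT hE => ?_⟩
  have I₁ := H₁ Ψ ⟨hT, hE.trans (add_le_add le_rfl (min_le_left _ _))⟩
  have I₂ := H₂ Ψ ⟨hT, hE.trans (add_le_add le_rfl (min_le_right _ _))⟩
  have key := lintegral_parseval_split n Ψ hT.1.continuous
  -- `(max B 0 + 1) n⁶ ≤ ∫ |ΣΦ|²|Ψ|² + B n⁶`
  have hmain : ENNReal.ofReal ((max B 0 + 1) * (n : ℝ) ^ 6) ≤
      (∫⁻ Φ : (Fin 3 → ZMod n) → ℂ, (‖∑ x, Φ x‖₊ : ℝ≥0∞) ^ 2 * (‖Ψ Φ‖₊ : ℝ≥0∞) ^ 2) +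
        ENNReal.ofReal (max B 0 * (n : ℝ) ^ 6) := by
    calc ENNReal.ofReal ((max B 0 + 1) * (n : ℝ) ^ 6)
        = ENNReal.ofReal ((n : ℝ) ^ 3) * ENNReal.ofReal ((max B 0 + 1) * (n : ℝ) ^ 3) := by
          rw [← ENNReal.ofReal_mul (by positivity)]
          congr 1
          ring
      _ ≤ ENNReal.ofReal ((n : ℝ) ^ 3) *
            ∫⁻ Φ : (Fin 3 → ZMod n) → ℂ, ENNReal.ofReal (∑ x, ‖Φ x‖ ^ 2) * (‖Ψ Φ‖₊ : ℝ≥0∞) ^ 2 :=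
          mul_le_mul' le_rfl I₁
      _ = (∫⁻ Φ : (Fin 3 → ZMod n) → ℂ, (‖∑ x, Φ x‖₊ : ℝ≥0∞) ^ 2 * (‖Ψ Φ‖₊ : ℝ≥0∞) ^ 2) +
            ∫⁻ Φ : (Fin 3 → ZMod n) → ℂ, ENNReal.ofReal (fluctuation n Φ) * (‖Ψ Φ‖₊ : ℝ≥0∞) ^ 2 :=
          key
      _ ≤ (∫⁻ Φ : (Fin 3 → ZMod n) → ℂ, (‖∑ x, Φ x‖₊ : ℝ≥0∞) ^ 2 * (‖Ψ Φ‖₊ : ℝ≥0∞) ^ 2) +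
            ENNReal.ofReal (B * (n : ℝ) ^ 6) := add_le_add le_rfl I₂
      _ ≤ (∫⁻ Φ : (Fin 3 → ZMod n) → ℂ, (‖∑ x, Φ x‖₊ : ℝ≥0∞) ^ 2 * (‖Ψ Φ‖₊ : ℝ≥0∞) ^ 2) +
            ENNReal.ofReal (max B 0 * (n : ℝ) ^ 6) :=
          add_le_add le_rfl (ENNReal.ofReal_le_ofReal
            (mul_le_mul_of_nonneg_right (le_max_left _ _) (by positivity)))
  calc ENNReal.ofReal (1 * (n : ℝ) ^ 6)
      = ENNReal.ofReal ((max B 0 + 1) * (n : ℝ) ^ 6) - ENNReal.ofReal (max B 0 * (n : ℝ) ^ 6) := by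
        rw [← ENNReal.ofReal_sub _ (by positivity)]
        congr 1
        ring
    _ ≤ ∫⁻ Φ : (Fin 3 → ZMod n) → ℂ, (‖∑ x, Φ x‖₊ : ℝ≥0∞) ^ 2 * (‖Ψ Φ‖₊ : ℝ≥0∞) ^ 2 :=
        tsub_le_iff_right.mpr hmain

/-- The skeleton as a (sorried-through-the-stubs) proof of the crux: `_of` applied to the two stubs as
registered (their full signatures are definitionally the bodies of `Goal.stub_*`). -/
theorem ChargedAnchorLRO_proof :
    Summit.AtomisticToContinuum.BoseEinsteinCondensation.Theses.BECChargeConjugationRP.ChargedAnchorLRO :=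
  ChargedAnchorLRO_of stub_onSiteMomentFloor stub_chargedInfraredBound

end

end Summit.AtomisticToContinuum.BoseEinsteinCondensation.Cruxes.ChargedAnchorLRO.Birth
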